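import Literature.Analysis.FluidPDE.KNSSTypeIRateLiouvilleDescent
import Literature.Analysis.FluidPDE.KNSSLiouvillePlanarHolds
import Literature.Analysis.FluidPDE.KNSSBlowupLimit
import Literature.Analysis.FluidPDE.LeiZhang2011BlowupEndgame
import HarnessLib

/-!
# Lei–Zhang 2011, Theorem 1.4, Case 2: the planar blow-up limit vanishes

Analysis/FluidPDE **proofs file** (theorems only: no definitions, no named facts, no `sorry`) on
the discharge path of the named fact
`Literature.Analysis.FluidPDE.LeiZhang2011_regularity_bmoStream` (Z. Lei, Q. S. Zhang,
J. Funct. Anal. 261 (2011) = arXiv:1011.5066, **Theorem 1.4**, proof §4, Case 2, pp. 12–13).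

Case 2 of the printed proof (`r_k Q_k → ∞`: the near-maxima approach the axis slowly compared
with the blow-up scale) rescales at `x_k`; the axis recedes, the limit `u` is independent of the
tangential coordinate and has no tangential component, "is a bounded ancient solution to the 2D
Navier–Stokes equations. By Theorem 5.1 in [KNSS], the limit `u = u^r(t)ν + u^z(t)e_z` … the
boundedness of the stream function of `u` in BMO norm implies that `u = 0`. This contradiction
shows that Case 2 can not occur either." This file proves the conclusion for the limit object:

* `case2_limit_eq_zero` — a bounded weak solution `v` on `ℝ³ × (−∞, 0)` (KNSS class), jointly
  continuous, with weakly divergence-free slices, invariant under `x ↦ x + δe₂`, with `v₁ ≡ 0`,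
  each of whose slices is a uniform-on-balls limit of fields with differentiable stream
  functions of uniformly bounded `BMO` seminorm, vanishes on `(−∞, 0] × ℝ³`: planar trace
  (`IsBoundedWeakNSSolutionOn.planarTrace_of_lineInvariant`, `KNSSTypeIRateLiouvilleDescent`),
  KNSS Thm. 5.1 (`KNSS2009_liouville_planar_holds`), constancy of the planar components at every
  time (`planar_const_of_ae_const`, `KNSSTypeIRateLiouvilleMild`), the endgame
  `eq_zero_of_tendstoUniformlyOn_of_bmoStream` (`LeiZhang2011BlowupEndgame`), and
  `forall_eq_zero_of_ae_slice_eq_zero` (`KNSSBlowupLimit`) for the final time;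
* `isWeaklyDivFree_of_tendsto` — every (not only a.e.) slice of a pointwise limit of uniformly
  bounded continuous fields with weakly divergence-free slices is weakly divergence free (the
  hypothesis of the planar trace lemma).

The geometric inputs of Case 2 (rescaling at the rotated near-maximum, symmetry about the
receding axis, smallness of the tangential component) are in `LeiZhang2011ZoomOffAxis`; the
assembly of Theorem 1.4 consumes this file together with the Case 1 conclusion.

## Mathlib / tree search

Reused (all proved in the tree): `IsBoundedWeakNSSolutionOn.planarTrace_of_lineInvariant`,
`KNSS2009_liouville_planar_holds`, `planar_const_of_ae_const`,
`eq_zero_of_tendstoUniformlyOn_of_bmoStream`, `forall_eq_zero_of_ae_slice_eq_zero`; the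
dominated-convergence block of `isBoundedWeakNSSolutionOn_of_tendsto` (`KNSSBlowupLimit`).

## References

* Z. Lei, Q. S. Zhang, J. Funct. Anal. 261 (2011) = arXiv:1011.5066: Thm. 1.4, proof §4, Case 2
  (pp. 12–13). [LeiZhang2011]
* G. Koch, N. Nadirashvili, G. Seregin, V. Šverák, Acta Math. 203 (2009) = arXiv:0709.3599,
  Thm. 5.1 (p. 9), proof of Thm. 6.2 (p. 13). [KochNadirashviliSereginSverak2009]
-/

noncomputable section

open MeasureTheory Set Function Filter Topology TopologicalSpace Metric WithLp
open scoped InnerProductSpace RealInnerProductSpace NNReal ENNReal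

namespace Literature.Analysis.FluidPDE

open Literature.Analysis.FunctionSpaces

/-! ### Weak divergence-freeness of every slice of the limit -/

/-- **Every slice of the blow-up limit is weakly divergence free** (not only a.e. slice, as in
`isBoundedWeakNSSolutionOn_of_tendsto`): if the approximating fields have weakly divergence-free
slices at every time of their intervals `(A_k, 0)`, `A_k → −∞`, are continuous and uniformly
bounded there, and converge pointwise, then `div v(t, ·) = 0` weakly for every `t < 0`
(dominated convergence in `∫ ⟪V_k(t), ∇θ⟫ = 0`). [folklore] -/
theorem isWeaklyDivFree_of_tendsto {M : ℝ} {A : ℕ → ℝ}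
    {V : ℕ → ℝ → EuclideanSpace ℝ (Fin 3) → EuclideanSpace ℝ (Fin 3)}
    {v : ℝ → EuclideanSpace ℝ (Fin 3) → EuclideanSpace ℝ (Fin 3)} (hA : Tendsto A atTop atBot)
    (hdiv : ∀ k, ∀ t ∈ Ioo (A k) 0, IsWeaklyDivFree (V k t))
    (hcont : ∀ k, ContinuousOn (uncurry (V k)) (Ioo (A k) 0 ×ˢ univ))
    (hbd : ∀ k, ∀ t ∈ Ioo (A k) 0, ∀ x, ‖V k t x‖ ≤ M)
    (hlim : ∀ t < 0, ∀ x, Tendsto (fun k => V k t x) atTop (𝓝 (v t x))) :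
    ∀ t < 0, IsWeaklyDivFree (v t) := by
  have hev : ∀ a : ℝ, ∀ᶠ k in atTop, A k < a := fun a => hA.eventually (eventually_lt_atBot a)
  intro t ht0 θ hθ
  have hθ1 : ContDiff ℝ 1 θ := contDiff_infty.1 hθ.contDiff 1
  have hgc : HasCompactSupport (gradient θ) := by
    have : gradient θ = (fun L => (InnerProductSpace.toDual ℝ (EuclideanSpace ℝ (Fin 3))).symm L) ∘
        fderiv ℝ θ := rfl
    rw [this]
    exact (hθ.hasCompactSupport.fderiv (𝕜 := ℝ)).comp_left (by simp)
  have hθi : Integrable (fun x => M * ‖gradient θ x‖) volume :=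
    (((continuous_gradient_of_contDiff hθ1).integrable_of_hasCompactSupport hgc).norm).const_mul M
  have hlimθ : Tendsto (fun k => ∫ x, ⟪V k t x, gradient θ x⟫) atTop
      (𝓝 (∫ x, ⟪v t x, gradient θ x⟫)) := by
    refine tendsto_integral_filter_of_dominated_convergence (fun x => M * ‖gradient θ x‖)
      ?_ ?_ hθi (Eventually.of_forall fun x => (hlim t ht0 x).inner tendsto_const_nhds)
    · filter_upwards [hev t] with k hk
      have hsl : Continuous (V k t) :=
        ((hcont k).comp_continuous (Continuous.prodMk_right t)
          fun x => ⟨⟨hk, ht0⟩, mem_univ x⟩)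
      exact (hsl.inner (continuous_gradient_of_contDiff hθ1)).aestronglyMeasurable
    · filter_upwards [hev t] with k hk
      exact Eventually.of_forall fun x => (norm_inner_le_norm _ _).trans
        (mul_le_mul_of_nonneg_right (hbd k t ⟨hk, ht0⟩ x) (norm_nonneg _))
  have hzero : ∀ᶠ k in atTop, ∫ x, ⟪V k t x, gradient θ x⟫ = 0 := by
    filter_upwards [hev t] with k hk
    exact hdiv k t ⟨hk, ht0⟩ θ hθ
  exact tendsto_nhds_unique hlimθ (tendsto_const_nhds.congr' (hzero.mono fun k hk => hk.symm))

/-! ### Case 2: the planar limit vanishes -/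

/-- **Lei–Zhang 2011, Theorem 1.4, Case 2 — the limit vanishes.** Let `v` be the blow-up limit
of Case 2: a bounded weak solution of Navier–Stokes (`ν = 1`) on `ℝ³ × (−∞, 0)`, jointly
continuous, with weakly divergence-free slices, invariant under `x ↦ x + δ e₂` (the receding
axes, `eq_of_tendstoLocallyUniformly_of_rot_about`) and with vanishing tangential component
`v₁ ≡ 0` (from `|Γ| ≤ C₁` and `r_k Q_k → ∞`), and suppose that at every `t < 0` the slice
`v(t, ·)` is the uniform limit on balls of fields `w_k` with differentiable stream functions of
uniformly bounded `BMO` seminorm. Then `v = 0` on `(−∞, 0] × ℝ³`. Printed proof (arXiv:1011.5066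
p. 13): "`u = u^r(x₁, z, t)e₁ + u^z(x₁, z, t)e_z` is a bounded ancient solution to the 2D
Navier–Stokes equations. By Theorem 5.1 in [KNSS], `u = u^r(t)ν + u^z(t)e_z` … the boundedness of
the stream function of `u` in BMO norm implies that `u = 0`". Here: the planar trace is a
bounded weak solution on `ℝ² × (−∞, 0)` (`IsBoundedWeakNSSolutionOn.planarTrace_of_lineInvariant`),
KNSS Thm. 5.1 (`KNSS2009_liouville_planar_holds`) and continuity make the planar components
constant in space at every `t < 0` (`planar_const_of_ae_const`), `v₁ ≡ 0` makes the whole slice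
constant, the endgame `eq_zero_of_tendstoUniformlyOn_of_bmoStream` kills the constant, and
continuity reaches `t = 0`. [cite: LeiZhang2011, Thm. 1.4, proof §4, Case 2 (arXiv p. 13)] -/
theorem case2_limit_eq_zero {v : ℝ → EuclideanSpace ℝ (Fin 3) → EuclideanSpace ℝ (Fin 3)}
    (hweak : IsBoundedWeakNSSolutionOn (Iio 0) isOpen_Iio 1 v) (hvcont : Continuous (uncurry v))
    (hdiv : ∀ t < 0, IsWeaklyDivFree (v t))
    (hinv : ∀ t < 0, ∀ (x : EuclideanSpace ℝ (Fin 3)) (δ : ℝ),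
      v t (x + EuclideanSpace.single 1 δ) = v t x)
    (htan : ∀ t < 0, ∀ x, v t x 1 = 0)
    (happrox : ∀ t < 0, ∃ (w B : ℕ → EuclideanSpace ℝ (Fin 3) → EuclideanSpace ℝ (Fin 3)) (K : ℝ≥0),
      (∀ k, Differentiable ℝ (B k)) ∧ (∀ k, curl (B k) =ᵐ[volume] w k) ∧
      (∀ k, eBMOSeminormVec (B k) ≤ K) ∧ (∀ k, LocallyIntegrable (w k) volume) ∧
      ∀ r : ℝ, 0 < r →
        TendstoUniformlyOn w (v t) atTop (closedBall (0 : EuclideanSpace ℝ (Fin 3)) r)) :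
    ∀ t ≤ 0, ∀ x, v t x = 0 := by
  have hcont' : ContinuousOn (uncurry v) (Iio 0 ×ˢ univ) := hvcont.continuousOn
  -- the planar trace and KNSS Theorem 5.1
  have hV := hweak.planarTrace_of_lineInvariant hcont' (fun t ht => hinv t ht) fun t ht => hdiv t ht
  obtain ⟨b, -, -, hae⟩ := KNSS2009_liouville_planar_holds hV
  have hconst := planar_const_of_ae_const hcont' hinv hae
  -- every slice is constant, hence zero
  have hslice : ∀ t < 0, ∀ x, v t x = 0 := by
    intro t ht
    have hc : ∀ x, v t x = v t 0 := fun x => by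
      obtain ⟨h0, h2⟩ := hconst t ht x
      ext i
      fin_cases i
      · exact h0
      · simp [htan t ht x, htan t ht 0]
      · exact h2
    obtain ⟨w, B, K, hBd, hcurl, hbmo, hwi, hconv⟩ := happrox t ht
    have hvi : LocallyIntegrable (v t) volume :=
      (hvcont.comp (Continuous.prodMk_right t)).locallyIntegrable
    have huc : v t =ᵐ[volume] fun _ => v t 0 := Eventually.of_forall hc
    have h0 : v t 0 = 0 :=
      eq_zero_of_tendstoUniformlyOn_of_bmoStream hBd hcurl hbmo hwi hvi hconv huc
    intro x
    rw [hc x, h0]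
  -- up to the final time, by continuity
  refine forall_eq_zero_of_ae_slice_eq_zero hvcont ?_
  filter_upwards [ae_restrict_mem measurableSet_Iio] with t ht
  exact Eventually.of_forall fun x => hslice t ht x

end Literature.Analysis.FluidPDE
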